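import Literature.NumberTheory.EllipticCurves.CPMuDescentPhiSide
import Literature.NumberTheory.EllipticCurves.TwistedKummerCharacterNorm
import HarnessLib

/-!
# The `3`-isogeny descent with a TWISTED kernel `ℤ/3 ⊗ χ`: the kernel image theorem and
# «`Ш(E/ℚ) ∩ ker φ_* = 0` from the box over the Kummer field `L`» (Silverman X.4.2 (a); Cohen–Pazuki 2009, Prop. 1.4 (2),
# Prop. 2.2 — the case `D, D̂ ∉ ℚ*² ∪ −3ℚ*²`)

Topic `NumberTheory/EllipticCurves`. Sequel of `TwistedKummerCharacterNorm` and twisted companion of the tree's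
`ThreeKernelCocycles.exists_hom_of_galH1Map_eq_zero` (RATIONAL kernel point `T`) and
`CPMuDescentPhiSide.eq_zero_of_mem_sha_of_galH1Map_geomHom_eq_zero_of_box` (the `K3 = ℚ(ζ₃)`-box). For a `3`-isogeny
`φ : E → E'` over `ℚ` whose kernel `{O, ±T}` is the Galois module `ℤ/3 ⊗ ψ` for a quadratic character `ψ` (Mordell curves
`y² = x³ + k`, `T = (0, √k)`, `ψ = χ_k`; programme memo
`Summits/BirchSwinnertonDyer/BirchSwinnertonDyer/Cruxes/HeegnerTwistCouplingInSupply/TWISTED-DESCENT-PROGRAMME-w4g32.md`):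

* §1 ★ `exists_twistedHom_of_galH1Map_eq_zero` (any field `K` of characteristic `0`): if `σ • T = ψ(σ) T` then every
  class `c ∈ H¹(K, E)` killed by `φ_*` is the class of a cocycle `σ ↦ n(σ) T` with `n : Γ_K → ℤ/3ℤ` locally constant and
  `ψ`-TWISTED: `n(στ) = n(σ) + ψ(σ) n(τ)` (Silverman X.4.2 (a): `H¹(K, E[φ]) ↠ WC(E/K)[φ]`).
* §2 ★★ `eq_zero_of_mem_sha_of_galH1Map_eq_zero_of_twisted_box` (over `ℚ`): let `L` be a number field, GALOIS of degree
  prime to `3` over `ℚ`, `√−3 ∉ L`, with an involution `c` and a lift `c̄` negating `√−3`, such that on `Γ_L` the twist `ψ` is the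
  cyclotomic sign (`ψ ∘ res = ε_L`) and `ψ(σ̃^{±1}) = 1`; let `𝒯` be a `μ₃`-kernel datum on `E_L` whose point is the image of `T`.
  If the `L`-BOX is sharp — every torsor class `[C_u] ∈ Ш(E_L/L)` with `u · c(u)` a `c`-fixed cube vanishes — then
  `Ш(E/ℚ) ∩ ker φ_* = 0`: `c = [σ ↦ n(σ)T]` (§1), `n ∘ res = κ_u + ∂` with `u` of cube norm (`TwistedKummerCharacterNorm`),
  `res c = [C_u] ∈ Ш(E_L/L)` vanishes, and restriction is injective on `Ш[3]` (`ShaRestrictionIndex`).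

What is NOT here: the boxes themselves (S-units and local images over `L`), the `φ̂`-side assembly to `Ш[3] = 0`, the Vélu
isogeny of `y² = x³ + k` over `ℚ`. Everything here is proved; no definitions, no named facts.

## References

* [SilvermanAEC2009] J. H. Silverman, *The Arithmetic of Elliptic Curves*, 2nd ed., Thm. X.4.2 (a), App. B §2.
* [CohenPazuki2009] H. Cohen, F. Pazuki, Acta Arith. 140 (2009), Proposition 1.4 (2), Theorem 2.1, Proposition 2.2.
* Tree: `ThreeKernelCocycles`, `CPMuDescentPhiSide` (template), `Curve6137PhiSideSelmer` (`resBaseChange_oneCocycleClass`),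
  `MuThreeTorsorClass`, `ShaRestriction(Index)`, `TwistedKummerCharacterNorm`.
-/

noncomputable section

open scoped Classical

namespace Literature.NumberTheory.EllipticCurves

namespace TwistedKummer

open _root_.WeierstrassCurve GaloisRepresentations MordellDescent CPMuDescent

universe u

/-! ## §1 The `ψ`-twisted `ℤ/3`-kernel image theorem -/

section Image

variable {K : Type u} [Field K] [CharZero K] {W W' : WeierstrassCurve K} (T : geomPoints W) (hT0 : T ≠ 0)
  (hTT : T + T = -T) (ψ : Field.absoluteGaloisGroup K → ZMod 3)
  (hψT : ∀ σ : Field.absoluteGaloisGroup K, σ • T = (ψ σ).val • T)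
  (f : geomPoints W →+ geomPoints W')
  (hf : ∀ (σ : Field.absoluteGaloisGroup K) (P : geomPoints W), f (σ • P) = σ • f P)

include hTT in
omit [CharZero K] in
/-- `(a b).val • T = a.val • (b.val • T)` (as `3T = O`). [cite: SilvermanAEC2009, Thm. X.4.2 (a)] -/
theorem val_mul_nsmul (a b : ZMod 3) : ((a * b).val • T : geomPoints W) = a.val • (b.val • T) := by
  rw [← mul_nsmul', ZMod.val_mul]
  conv_rhs => rw [← Nat.mod_add_div (a.val * b.val) 3, add_nsmul, three_mul_nsmul T hTT, add_zero]

include hT0 hTT hψT in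
omit [CharZero K] in
/-- ★ **The `ψ`-twisted `ℤ/3`-kernel image theorem.** For a point `T` of order `3` with `σ • T = ψ(σ) T` and a
`Γ_K`-equivariant surjection `f : W(K̄) → W'(K̄)` with `ker f ⊆ {O, ±T}`, a class `c ∈ H¹(K, W)` killed by `f_*` is the class
of a cocycle `σ ↦ n(σ) T` with `n : Γ_K → ℤ/3ℤ` locally constant and `ψ`-TWISTED, `n(στ) = n(σ) + ψ(σ) n(τ)`:
`f ∘ g = ∂(fP)` makes `g − ∂P` take values in `{O, ±T}`, and the cocycle identity with `σT = ψ(σ)T` is the twisted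
additivity. [cite: SilvermanAEC2009, Thm. X.4.2 (a)] -/
theorem exists_twistedHom_of_galH1Map_eq_zero (hsurj : Function.Surjective f)
    (hker : ∀ P : geomPoints W, f P = 0 → P = 0 ∨ P = T ∨ P = -T)
    (c : W.galH1) (hc : galH1Map f hf c = 0) :
    ∃ (g : contOneCocycles (discreteTopRep (Field.absoluteGaloisGroup K) (geomPoints W)))
      (n : Field.absoluteGaloisGroup K → ZMod 3),
      (∀ σ, g.1 σ = (n σ).val • T) ∧ (∀ σ τ, n (σ * τ) = n σ + ψ σ * n τ) ∧
        IsLocallyConstant n ∧ oneCocycleClass _ g = c := by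
  obtain ⟨g, rfl⟩ := oneCocycleClass_surjective _ c
  rw [galH1Map_oneCocycleClass, oneCocycleClass_eq_zero_iff] at hc
  obtain ⟨Q, hQ⟩ := hc
  obtain ⟨P, rfl⟩ := hsurj Q
  have hQ' : ∀ σ : Field.absoluteGaloisGroup K, f (g.1 σ) = σ • f P - f P := fun σ => hQ σ
  set g' := g - cobCocycle P (continuous_smul_geomPoints _ P) with hg'
  have hg'val : ∀ σ : Field.absoluteGaloisGroup K, g'.1 σ = g.1 σ - (σ • P - P) := fun σ => rfl
  have hg'ker : ∀ σ : Field.absoluteGaloisGroup K, g'.1 σ = 0 ∨ g'.1 σ = T ∨ g'.1 σ = -T := by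
    intro σ
    apply hker
    rw [hg'val, map_sub, map_sub, hf, hQ', sub_self]
  have hclass : oneCocycleClass _ g' = oneCocycleClass _ g := by
    rw [hg', oneCocycleClass_sub, oneCocycleClass_cobCocycle, sub_zero]
  choose n hn using fun σ => exists_val_nsmul_eq T hTT (hg'ker σ)
  have hinj := val_nsmul_injective T hT0 hTT
  have hnmul : ∀ σ τ : Field.absoluteGaloisGroup K, n (σ * τ) = n σ + ψ σ * n τ := by
    intro σ τ
    apply hinj
    simp only
    rw [hn, val_add_nsmul T hTT, hn, mul_comm (ψ σ) (n τ), val_mul_nsmul T hTT, ← hψT σ]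
    have e := g'.2 σ τ
    rw [discreteTopRep_ρ_apply] at e
    -- `g'(στ) = g'(σ) + σ g'(τ)` and `σ g'(τ) = (n τ).val • σT`
    have hσ : σ • g'.1 τ = (n τ).val • (σ • T) := by
      rw [← hn τ]
      exact map_nsmul (DistribSMul.toAddMonoidHom (geomPoints W) σ) _ T
    rw [hσ] at e
    exact e
  have hlc : IsLocallyConstant n := by
    have hglc : IsLocallyConstant g'.1 := (IsLocallyConstant.iff_continuous g'.1).mpr g'.1.continuous
    have hns : n = (fun x : geomPoints W =>
        if h : ∃ m : ZMod 3, (m.val • T : geomPoints W) = x then Classical.choose h else 0) ∘ g'.1 := by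
      funext σ
      simp only [Function.comp_apply]
      have hex : ∃ m : ZMod 3, (m.val • T : geomPoints W) = g'.1 σ := ⟨n σ, hn σ⟩
      rw [dif_pos hex]
      exact hinj ((hn σ).trans (Classical.choose_spec hex).symm)
    rw [hns]
    exact hglc.comp _
  exact ⟨g', n, fun σ => (hn σ).symm, hnmul, hlc, hclass⟩

include hTT hψT in
omit [CharZero K] in
/-- The twist `ψ` is multiplicative modulo `3T = O`: `(ψ(στ)).val • T = (ψ σ ψ τ).val • T`, hence (by injectivity of
`n ↦ n•T` when `T ≠ O`) `ψ(στ) = ψ(σ)ψ(τ)`. [cite: SilvermanAEC2009, Thm. X.4.2 (a)] -/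
theorem twist_mul (hT0 : T ≠ 0) (σ τ : Field.absoluteGaloisGroup K) : ψ (σ * τ) = ψ σ * ψ τ := by
  apply val_nsmul_injective T hT0 hTT
  simp only
  rw [← hψT, mul_smul, hψT τ, mul_comm (ψ σ) (ψ τ), val_mul_nsmul T hTT, ← hψT σ]
  exact map_nsmul (DistribSMul.toAddMonoidHom (geomPoints W) σ) _ T

end Image

/-! ## §2 `Ш(E/ℚ) ∩ ker φ_* = 0` from the box over the Kummer field `L` -/

section Restriction

variable {L : Type} [Field L] [NumberField L] [IsGalois ℚ L] (c : L ≃+* L) (hc2 : ∀ x : L, c (c x) = x)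
  (cbar : AlgebraicClosure L ≃+* AlgebraicClosure L)
  (hcbar : ∀ x : L, cbar (algebraMap L (AlgebraicClosure L) x) = algebraMap L (AlgebraicClosure L) (c x))
  (hθ : cbar (theta L) = -theta L)

include hc2 hcbar hθ in
/-- ★★ **`Ш(E/ℚ) ∩ ker φ_* = 0` from the `L`-box, twisted kernel.** Data: `E/ℚ`; a point `T ∈ E(ℚ̄)` of order `3` with
`σ • T = ψ(σ) T`; a `Γ_ℚ`-equivariant surjection `f` with `ker f ⊆ {O, ±T}` (the `3`-isogeny); a number field `L`, Galois over
`ℚ` of degree prime to `3`, `√−3 ∉ L`, with an involution `c` and a lift `c̄` of `c` negating `√−3`; the compatibilities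
`ψ ∘ res = ε_L`, `ψ(σ̃) = ψ(σ̃⁻¹) = 1`; a `μ₃`-kernel datum `𝒯` on `E_L` with `𝒯.T` = the image of `T`. Hypothesis `hbox` (the
SHARP `L`-box): every `[C_u]`, `u ∈ L*` with `u · c(u)` a `c`-fixed cube, lying in `Ш(E_L/L)` vanishes. Conclusion: every
`c ∈ Ш(E/ℚ)` with `f_* c = 0` is `0`. [cite: CohenPazuki2009, Proposition 1.4 (2) and Proposition 2.2]
[cite: SilvermanAEC2009, Thm. X.4.2 (a)] -/
theorem eq_zero_of_mem_sha_of_galH1Map_eq_zero_of_twisted_box (hL : ∀ q : L, q ^ 2 ≠ -3)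
    (hdeg : Nat.Coprime 3 (Module.finrank ℚ L)) {E E' : WeierstrassCurve ℚ}
    (T : geomPoints E) (hT0 : T ≠ 0) (hTT : T + T = -T) (ψ : Field.absoluteGaloisGroup ℚ → ZMod 3)
    (hψT : ∀ σ : Field.absoluteGaloisGroup ℚ, σ • T = (ψ σ).val • T)
    (hψres : ∀ τ : Field.absoluteGaloisGroup L, ψ (resGal (K := ℚ) L τ) = eps τ)
    (hψ1 : ψ (sigmaTilde cbar) = 1) (hψ2 : ψ (sigmaTilde cbar)⁻¹ = 1)
    (f : geomPoints E →+ geomPoints E')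
    (hf : ∀ (σ : Field.absoluteGaloisGroup ℚ) (P : geomPoints E), f (σ • P) = σ • f P)
    (hsurj : Function.Surjective f) (hker : ∀ P : geomPoints E, f P = 0 → P = 0 ∨ P = T ∨ P = -T)
    (𝒯 : MuThreeKernel (E.baseChange L))
    (hT_L : localPointsEquivGeomPoints E L (pointsMap E L T) = 𝒯.T)
    (hbox : ∀ {u : L} (hu : u ≠ 0), (∃ r : L, c r = r ∧ r ≠ 0 ∧ u * c u = r ^ 3) →
      𝒯.torsorClass hu ∈ (E.baseChange L).sha → 𝒯.torsorClass hu = 0)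
    {c₀ : E.galH1} (hc₀ : c₀ ∈ E.sha) (h0 : galH1Map f hf c₀ = 0) : c₀ = 0 := by
  -- Step A: `c₀ = [σ ↦ n(σ) T]` for a `ψ`-twisted locally constant `n`
  obtain ⟨g, n, hg, hn, hlc, hgc⟩ :=
    exists_twistedHom_of_galH1Map_eq_zero T hT0 hTT ψ hψT f hf hsurj hker c₀ h0
  -- Step B: `n ∘ res = κ_u + (ε − 1) j` with `u · c u` a fixed cube
  have hψmul : ∀ σ τ, ψ (σ * τ) = ψ σ * ψ τ := twist_mul T hTT ψ hψT hT0
  have hψsq : ∀ σ, ψ σ * ψ σ = 1 := by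
    intro σ
    -- `ψ σ ∈ {1, −1}`: `σ • T ∈ {O, ±T}`? No: from `σ σ⁻¹ = 1` and `ψ 1 = 1` we get `ψ σ ψ σ⁻¹ = 1`; values in `ℤ/3`
    -- square to `1` as soon as they are non-zero, and `ψ σ = 0` would give `σ • T = O`.
    have hne : ψ σ ≠ 0 := by
      intro h
      have := hψT σ
      rw [h, ZMod.val_zero, zero_nsmul, smul_eq_zero_iff_eq] at this
      exact hT0 this
    have : ∀ x : ZMod 3, x ≠ 0 → x * x = 1 := by decide
    exact this _ hne
  obtain ⟨u, hu, j, hκ, hnorm⟩ := exists_kummerExp_eq_resGal_twisted c hc2 cbar hcbar hθ hL n ψ hn hlc hψmul hψsq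
    hψres hψ1 hψ2
  -- Step C: `res c₀ = [C_u]` on `E_L`
  obtain ⟨g₁, hg₁, hres⟩ := resBaseChange_oneCocycleClass E L g
  have hg₁' : ∀ τ, g₁.1 τ = (n (resGal (K := ℚ) L τ)).val • 𝒯.T := by
    intro τ; rw [hg₁, hg, map_nsmul, map_nsmul, hT_L]
  -- the torsor cocycle of `u` differs from `g₁` by the coboundary of `j • T`
  have hg₂ : ∀ τ, (𝒯.torsorCocycle hu).1 τ = g₁.1 τ + (τ • 𝒯.chiT (j : ZMod 3) - 𝒯.chiT (j : ZMod 3)) := by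
    intro τ
    rw [MuThreeKernel.torsorCocycle_apply, MuThreeKernel.torsorFun, hκ τ, map_add, MuThreeKernel.chiT_eq_val_nsmul,
      ← hg₁' τ, MuThreeKernel.chiT_eps_sub_one_mul]
  have hclass : oneCocycleClass _ (𝒯.torsorCocycle hu) = oneCocycleClass _ g₁ := by
    have hsub : 𝒯.torsorCocycle hu - cobCocycle (𝒯.chiT (j : ZMod 3)) (continuous_smul_geomPoints _ _) = g₁ := by
      apply Subtype.ext; apply ContinuousMap.ext; intro τ
      change (𝒯.torsorCocycle hu).1 τ - (τ • 𝒯.chiT (j : ZMod 3) - 𝒯.chiT (j : ZMod 3)) = g₁.1 τ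
      rw [hg₂ τ, add_sub_cancel_right]
    rw [← hsub, oneCocycleClass_sub, oneCocycleClass_cobCocycle, sub_zero]
  have hres_sha : oneCocycleClass _ g₁ ∈ (E.baseChange L).sha := by
    rw [← hres]; exact resBaseChange_mem_sha _ L (hgc ▸ hc₀)
  have hsha_u : 𝒯.torsorClass hu ∈ (E.baseChange L).sha := by
    change oneCocycleClass _ (𝒯.torsorCocycle hu) ∈ _
    rw [hclass]; exact hres_sha
  have hzero : 𝒯.torsorClass hu = 0 := hbox hu hnorm hsha_u
  have hres0 : resBaseChange E L c₀ = 0 := by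
    rw [← hgc, hres, ← hclass]; exact hzero
  -- Step D: restriction is injective on `Ш[3]`
  set c' : E.sha := ⟨c₀, hc₀⟩ with hc'
  have h3T : (3 : ℕ) • T = 0 := by rw [succ_nsmul, two_nsmul, hTT, neg_add_cancel]
  have h3 : 3 • c' = 0 := by
    apply Subtype.ext
    change 3 • c₀ = 0
    rw [← hgc]
    refine nsmul_oneCocycleClass_eq_zero _ 3 fun σ => ?_
    rw [hg, ← mul_nsmul', mul_comm, mul_nsmul', h3T, nsmul_zero]
  have hres' : shaRestriction E L c' = 0 := Subtype.ext (by rw [coe_shaRestriction_apply]; exact hres0)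
  have := (shaRestriction_eq_zero_iff_of_coprime E L hdeg c' h3).mp hres'
  exact congrArg Subtype.val this

end Restriction

end TwistedKummer

end Literature.NumberTheory.EllipticCurves

end
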